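import Summits.AtomisticToContinuum.HydrodynamicLimit.Theses.StiffCollisionalRelaxation
import Summits.AtomisticToContinuum.HydrodynamicLimit.Theses.CollisionIsometryCLT
import Summits.AtomisticToContinuum.HydrodynamicLimit.Theorems.LocalSecondLaw.Negative.HomogeneousLLN
import Summits.AtomisticToContinuum.HydrodynamicLimit.Theorems.AprioriBounds.Negative.AllLambda
import Summits.AtomisticToContinuum.HydrodynamicLimit.Theorems.AprioriBounds.Negative.BlockDensityAveraging
import Summits.AtomisticToContinuum.HydrodynamicLimit.Theorems.DenseExcursion.Negative.Untied
import Literature.MathematicalPhysics.KineticTheory.HardSphereEulerProofs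

/-!
# The pre-shock a-priori crux at equilibrium: its hypotheses are instantiable, unconditionally

Negative-side support for the crux `StiffCollisionalRelaxation.AprioriBounds` (stmt-AtomisticToContinuum-14827,
rev 3 "pre-shock + dilute chamber"; the same `Prop` as `CollisionIsometryCLT.AprioriBoundsPreShock`,
`aprioriBoundsPreShock_iff`), by the standing disprover refuter-cdisprove-stmt-AtomisticToContinuum-14827-0
(cycle 4 of the `AprioriBounds` disproof chain; work file `Cruxes/AprioriBounds/Disproof.lean` §9).

The restated crux conditions its two a-priori bounds — (i) a time-averaged one-particle exponential velocity
moment, (ii) no empty and no jammed mesoscopic cell — on the conjunct's own prefix: a classical hard-sphere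
Euler solution `(ρ, u, θ)` on `[0, T)`, local Gibbs data whose `t = 0` fields converge to it
(`TendstoHydroFieldsAt … 0`), a horizon `0 < t < T`, and the dilute chamber `2ρσ³ < η₁` on `[0, t]`.  Earlier
refuter notes on this item (CRUX-ATTACK.md (d), 2026-08-16) held that no unconditional negative statement
about a conjunct-prefixed item is reachable "until the local Gibbs law of large numbers is proved".  That
floor is gone: the tree PROVES the `t = 0` law of large numbers (`localGibbs_lln_holds`, cluster expansion)
and identifies its limit at constant profiles (`LocalSecondLawNegative.homogeneous_lln_identified`: profiles
`(a₀, θ₀, u₀) = (1, θ₀, 0)`, limit fields `(1, 0, θ₀)`, every flow family, all `σ < σ₁ ≤ 1/2`), and constant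
states are classical hs-Euler solutions on every `[0, T)` (`IsHardSphereEulerSolutionDim.const`, in the tree as
`DenseExcursionUntied.isHardSphereEulerSolution_const`).  Hence:

* `integral_density_eq_one_of_tendstoHydroFieldsAt`, `exists_one_le_of_integral_eq_one`,
  `two_mul_pow_three_lt_of_dilute`: on every NON-VACUOUS instance of the crux the Euler density has unit
  mass, so `sup ρ(0, ·) ≥ 1` and the dilute clause already forces `2σ³ < η₁` — the crux is vacuous at every
  `σ ≥ (η₁/2)^{1/3}` and a prover may use `σ³ < η₁/2` freely (smallness of `σ` comes with smallness of `η₁`).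
* `equilibriumAprioriBounds_of_aprioriBounds` (UNCONDITIONAL): the crux implies its EQUILIBRIUM RUNG
  `EquilibriumAprioriBounds` — for the homogeneous local Gibbs states `(1, θ₀, 0)` and all small `σ`, (i) and
  (ii) hold through every flow family for EVERY `t > 0` (take `T := t + 1` and the constant solution).  This
  is the cheapest typed statement any proof of the crux must deliver (space–time large deviations for the
  invariant hard-sphere Gibbs law at mesoscopic scale `N^{-γ}`, uniformly over `[0, t] × 𝕋³`) and the first
  place a counterexample would have to live; the disprover's audit finds it TRUE (stationarity + static LD),
  so the crux survives on the merits, not on a technicality.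
* `aprioriBoundsAllLambda_false` (UNCONDITIONAL): the natural strengthening of the LIVE crux in which (i)'s
  exponential parameter is universal (`∀ λ > 0 ∃ C`) is FALSE — composed from the rung construction and the
  landed equilibrium refutation `aprioriBoundsI_allLambda_false_at_equilibrium` (`Negative/AllLambda.lean`,
  critical Maxwellian moment `λ = 1/(2θ₀)` along Alexander's flow).  So `λ` is dictated by the data (below
  `1/(2 sup θ)`), exactly as every consumer of (i) (`AdaptedWeightCLT`, the Sketch line's `stub_partOne`)
  already allows.
* `equilibrium_floor_le_one`: on the rung, every floor constant has `c₁ ≤ 1` (block averaging,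
  `Negative/BlockDensityAveraging.lean`), now an unconditional constraint on witnesses of the live crux.
-/

noncomputable section

open MeasureTheory Filter Set Topology
open scoped ENNReal

namespace Summit.AtomisticToContinuum.HydrodynamicLimit.Theorems.AprioriBoundsNegative

open Literature.MathematicalPhysics.KineticTheory Literature.Analysis.FluidPDE
open Summit.AtomisticToContinuum.HydrodynamicLimit.Theses.StiffCollisionalRelaxation (AprioriBounds)

/-! ## §0 The two route declarations are one `Prop`; the crux in (i)/(ii) vocabulary -/

/-- `CollisionIsometryCLT.AprioriBoundsPreShock` (rank 5) and `StiffCollisionalRelaxation.AprioriBounds`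
(rank 4) are syntactically the same statement (item stmt-AtomisticToContinuum-14827). -/
theorem aprioriBoundsPreShock_iff :
    Summit.AtomisticToContinuum.HydrodynamicLimit.Theses.CollisionIsometryCLT.AprioriBoundsPreShock ↔
      AprioriBounds :=
  Iff.rfl

/-- Component (i) of the crux at reduced diameter `σ`, profiles, flow family and horizon `t`:
`∃ λ > 0, C` with `P_N{C < ∫₀ᵗ (N+1)⁻¹∑ᵢ exp(λ|vᵢ(s)|²) ds} → 0`. -/
def PartOneAt (σ : ℝ) (a₀ θ₀ : T3 → ℝ) (u₀ : T3 → V3)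
    (Φ : (N : ℕ) → HardSphereFlow (Torus.geometry (Fin 3)) (hsDiameter σ N) (N + 1)) (t : ℝ) : Prop :=
  ∃ lam Cexp : ℝ, 0 < lam ∧ Tendsto (fun N : ℕ => localGibbsLaw σ a₀ u₀ θ₀ N (Φ N)
    {z | Cexp < ∫ s in Icc 0 t, ∫ y, Real.exp (lam * ‖y.2‖ ^ 2) ∂(empiricalMeasure ((Φ N).flow s z))})
    atTop (𝓝 0)

/-- Component (ii) of the crux at `σ`, profiles, flow family and horizon `t`: for every admissible kernel
family, `∃ c₁ > 0` with `P_N{∃ s ≤ t, ∃ x, ρ̄(s,x) < c₁ ∨ 1 < ρ̄(s,x)σ³} → 0`. -/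
def PartTwoAt (σ : ℝ) (a₀ θ₀ : T3 → ℝ) (u₀ : T3 → V3)
    (Φ : (N : ℕ) → HardSphereFlow (Torus.geometry (Fin 3)) (hsDiameter σ N) (N + 1)) (t : ℝ) : Prop :=
  ∀ (γ C : ℝ) (φ : ℕ → T3 → ℝ), 0 < γ → γ ≤ 1 / 15 →
    ((∀ N, Literature.Analysis.FunctionSpaces.Torus.IsSmooth (φ N)) ∧ (∀ N y, 0 ≤ φ N y) ∧
      (∀ N, ∫ y, φ N y = 1) ∧
      (∀ (N : ℕ) y, ((N : ℝ) + 1) ^ (-γ) ≤ Torus.euclidDist y 0 → φ N y = 0) ∧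
      (∀ (N : ℕ) y, φ N y ≤ C * ((N : ℝ) + 1) ^ (3 * γ)) ∧
      (∀ (N : ℕ) y, ‖Literature.Analysis.FunctionSpaces.Torus.gradient (φ N) y‖ ≤
        C * ((N : ℝ) + 1) ^ (4 * γ))) →
    ∃ c₁ : ℝ, 0 < c₁ ∧ Tendsto (fun N : ℕ => localGibbsLaw σ a₀ u₀ θ₀ N (Φ N)
      {z | ∃ s ∈ Icc 0 t, ∃ x : T3,
        empiricalDensityField ((Φ N).flow s z) (fun y => φ N (y - x)) < c₁ ∨
          1 < empiricalDensityField ((Φ N).flow s z) (fun y => φ N (y - x)) * σ ^ 3}) atTop (𝓝 0)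

/-- The crux, unfolded in this vocabulary (definitional). -/
theorem aprioriBounds_iff :
    AprioriBounds ↔
      ∀ (a₀ θ₀ : T3 → ℝ) (u₀ : T3 → V3), Continuous a₀ → Continuous θ₀ → Continuous u₀ →
        (∀ x, 0 < a₀ x) → (∀ x, 0 < θ₀ x) →
        ∃ σ₀ : ℝ, 0 < σ₀ ∧ ∃ η₁ : ℝ, 0 < η₁ ∧ ∀ σ : ℝ, 0 < σ → σ < σ₀ →
          ∀ (T : ℝ) (ρ θ : ℝ → T3 → ℝ) (u : ℝ → T3 → V3), IsHardSphereEulerSolution σ T ρ u θ →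
          ∀ Φ : (N : ℕ) → HardSphereFlow (Torus.geometry (Fin 3)) (hsDiameter σ N) (N + 1),
            TendstoHydroFieldsAt (fun N => localGibbsLaw σ a₀ u₀ θ₀ N (Φ N)) Φ ρ u θ 0 →
            ∀ t : ℝ, 0 < t → t < T → (∀ s ∈ Icc 0 t, ∀ x, 2 * ρ s x * σ ^ 3 < η₁) →
              PartOneAt σ a₀ θ₀ u₀ Φ t ∧ PartTwoAt σ a₀ θ₀ u₀ Φ t :=
  Iff.rfl

/-! ## §1 Normalisation: on a non-vacuous instance `∫ρ = 1`, so the dilute clause forces `2σ³ < η₁` -/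

/-- **Unit mass of the limit density.**  If the empirical fields at time `t` converge in probability, under
PROBABILITY laws, to those of `(ρ, u, θ)(t)`, then `∫ ρ(t, ·) = 1`: test the density against `χ ≡ 1`, whose
empirical field is identically `1` (`empiricalDensityField_one`).  (If `ρ t` were not integrable the
Bochner integral would be `0` and the same contradiction arises, so integrability is forced too.) -/
theorem integral_density_eq_one_of_tendstoHydroFieldsAt {ε : ℕ → ℝ}
    {P : (N : ℕ) → Measure (Config (N + 1) (Fin 3) T3)} (hP : ∀ N, IsProbabilityMeasure (P N))
    {Φ : (N : ℕ) → HardSphereFlow (Torus.geometry (Fin 3)) (ε N) (N + 1)}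
    {ρ θ : ℝ → T3 → ℝ} {u : ℝ → T3 → V3} {t : ℝ}
    (h : TendstoHydroFieldsAt P Φ ρ u θ t) : ∫ x, ρ t x = 1 := by
  by_contra hne
  have hk : 0 < |1 - ∫ x, ρ t x| := abs_pos.2 (sub_ne_zero.2 (Ne.symm hne))
  have hd := (h (fun _ => 1) continuous_const (|1 - ∫ x, ρ t x| / 2) (by positivity)).1
  have hint : ∫ x : T3, (fun _ : T3 => (1 : ℝ)) x * ρ t x = ∫ x, ρ t x := by simp
  have hone : ∀ N, (1 : ℝ≥0∞) ≤ P N {z | |1 - ∫ x, ρ t x| / 2 <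
      |empiricalDensityField ((Φ N).flow t z) (fun _ => 1) -
        ∫ x : T3, (fun _ : T3 => (1 : ℝ)) x * ρ t x|} := by
    intro N
    haveI := hP N
    rw [← measure_univ (μ := P N)]
    refine measure_mono fun z _ => ?_
    show |1 - ∫ x, ρ t x| / 2 < |empiricalDensityField ((Φ N).flow t z) (fun _ => 1) -
      ∫ x : T3, (fun _ : T3 => (1 : ℝ)) x * ρ t x|
    rw [empiricalDensityField_one (Nat.succ_ne_zero N), hint]
    exact half_lt_self hk
  have h10 : (1 : ℝ≥0∞) ≤ 0 := ge_of_tendsto' hd hone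
  exact absurd h10 (by simp)

/-- A continuous function of unit mass on the unit torus takes a value `≥ 1` somewhere. -/
theorem exists_one_le_of_integral_eq_one {f : T3 → ℝ} (hf : Continuous f) (h1 : ∫ x, f x = 1) :
    ∃ x, 1 ≤ f x := by
  by_contra h
  push Not at h
  obtain ⟨xM, -, hxM⟩ := isCompact_univ.exists_isMaxOn univ_nonempty hf.continuousOn
  have hM : ∀ x, f x ≤ f xM := fun x => isMaxOn_iff.mp hxM x (mem_univ x)
  have hle : ∫ x, f x ≤ ∫ _x : T3, f xM := integral_mono hf.integrable_unitAddTorus (integrable_const _) hM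
  have hc : ∫ _x : T3, f xM = f xM := by simp
  linarith [h xM]

/-- On a non-vacuous instance of the crux's prefix the Euler density at time `0` reaches `1`:
classical solution on `[0, T)` with `0 < T` (continuity of `ρ(0,·)`), probability laws, `t = 0` LLN. -/
theorem exists_one_le_density_zero {σ T : ℝ} {ρ θ : ℝ → T3 → ℝ} {u : ℝ → T3 → V3}
    (hsol : IsHardSphereEulerSolution σ T ρ u θ) (hT : 0 < T)
    {P : (N : ℕ) → Measure (Config (N + 1) (Fin 3) T3)} (hP : ∀ N, IsProbabilityMeasure (P N))
    {ε : ℕ → ℝ} {Φ : (N : ℕ) → HardSphereFlow (Torus.geometry (Fin 3)) (ε N) (N + 1)}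
    (hLLN : TendstoHydroFieldsAt P Φ ρ u θ 0) : ∃ x, 1 ≤ ρ 0 x :=
  exists_one_le_of_integral_eq_one
    (hsol.smooth_density.isSmooth_slice (⟨le_rfl, hT⟩ : (0 : ℝ) ∈ Ico 0 T)).continuous
    (integral_density_eq_one_of_tendstoHydroFieldsAt hP hLLN)

/-- **The dilute clause already makes `σ` small.**  On a non-vacuous instance of the crux (classical
solution, `0 ≤ t < T`, probability laws, `t = 0` LLN) the chamber clause `∀ s ≤ t, ∀ x, 2ρ(s,x)σ³ < η₁`
forces `2σ³ < η₁`.  Consequently the crux is VACUOUS at every `σ ≥ (η₁/2)^{1/3}`, and a prover may assume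
`σ³ < η₁/2` wherever the hypotheses are in force. -/
theorem two_mul_pow_three_lt_of_dilute {σ T η₁ t : ℝ} {ρ θ : ℝ → T3 → ℝ} {u : ℝ → T3 → V3}
    (hσ : 0 ≤ σ) (hsol : IsHardSphereEulerSolution σ T ρ u θ) (ht : 0 ≤ t) (htT : t < T)
    {P : (N : ℕ) → Measure (Config (N + 1) (Fin 3) T3)} (hP : ∀ N, IsProbabilityMeasure (P N))
    {ε : ℕ → ℝ} {Φ : (N : ℕ) → HardSphereFlow (Torus.geometry (Fin 3)) (ε N) (N + 1)}
    (hLLN : TendstoHydroFieldsAt P Φ ρ u θ 0)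
    (hdil : ∀ s ∈ Icc 0 t, ∀ x, 2 * ρ s x * σ ^ 3 < η₁) : 2 * σ ^ 3 < η₁ := by
  obtain ⟨x, hx⟩ := exists_one_le_density_zero hsol (lt_of_le_of_lt ht htT) hP hLLN
  have h := hdil 0 ⟨le_rfl, ht⟩ x
  have hσ3 : 0 ≤ σ ^ 3 := pow_nonneg hσ 3
  nlinarith

/-- The same for the crux's own laws: for `σ ≤ 1/2` the local Gibbs laws are probability measures
(`isProbabilityMeasure_localGibbsLaw`), so nothing but the profile hypotheses is needed. -/
theorem two_mul_pow_three_lt_of_dilute_localGibbs {σ T η₁ t : ℝ} {a₀ θ₀ : T3 → ℝ} {u₀ : T3 → V3}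
    (ha : Continuous a₀) (hθ : Continuous θ₀) (hu : Continuous u₀) (ha0 : ∀ x, 0 < a₀ x)
    (hθ0 : ∀ x, 0 < θ₀ x) (hσ : 0 ≤ σ) (hσ2 : σ ≤ 1 / 2)
    {ρ θ : ℝ → T3 → ℝ} {u : ℝ → T3 → V3} (hsol : IsHardSphereEulerSolution σ T ρ u θ)
    (ht : 0 ≤ t) (htT : t < T)
    {Φ : (N : ℕ) → HardSphereFlow (Torus.geometry (Fin 3)) (hsDiameter σ N) (N + 1)}
    (hLLN : TendstoHydroFieldsAt (fun N => localGibbsLaw σ a₀ u₀ θ₀ N (Φ N)) Φ ρ u θ 0)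
    (hdil : ∀ s ∈ Icc 0 t, ∀ x, 2 * ρ s x * σ ^ 3 < η₁) : 2 * σ ^ 3 < η₁ :=
  two_mul_pow_three_lt_of_dilute hσ hsol ht htT
    (fun N => isProbabilityMeasure_localGibbsLaw ha hθ hu ha0 hθ0 hσ2 N (Φ N)) hLLN hdil

/-! ## §2 The equilibrium rung (unconditional) -/

/-! Constant states are classical hard-sphere Euler solutions on every `[0, T)`: the tree's
`DenseExcursionUntied.isHardSphereEulerSolution_const` (all derivatives vanish). -/

/-- **The equilibrium rung of the crux.**  For the homogeneous local Gibbs states with activity `1`, zero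
drift and constant temperature `θ₀ > 0` there is `σ₀ > 0` such that for all `0 < σ < σ₀`, EVERY flow
family and EVERY horizon `t > 0`, components (i) and (ii) hold.  (The invariant Gibbs law: (i) is a
one-time large deviation transported by stationarity, for `λ < 1/(2θ₀)`; (ii) is a space–time
mesoscopic large-deviation bound for the low-density hard-sphere gas.  Believed TRUE; unproved.) -/
def EquilibriumAprioriBounds : Prop :=
  ∀ θ₀ : ℝ, 0 < θ₀ → ∃ σ₀ : ℝ, 0 < σ₀ ∧ ∀ σ : ℝ, 0 < σ → σ < σ₀ →
    ∀ Φ : (N : ℕ) → HardSphereFlow (Torus.geometry (Fin 3)) (hsDiameter σ N) (N + 1),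
      ∀ t : ℝ, 0 < t →
        PartOneAt σ (fun _ => 1) (fun _ => θ₀) (fun _ => 0) Φ t ∧
          PartTwoAt σ (fun _ => 1) (fun _ => θ₀) (fun _ => 0) Φ t

/-- **The crux implies its equilibrium rung, unconditionally.**  At the profiles `(1, θ₀, 0)` the crux's
prefix is discharged by the constant solution `(1, 0, θ₀)` on `[0, t + 1)`
(`DenseExcursionUntied.isHardSphereEulerSolution_const`)
and the PROVED, identified `t = 0` law of large numbers (`homogeneous_lln_identified`, every flow family,
`σ < σ₁`); the chamber clause reads `2σ³ < η₁`, which holds once `σ < min 1 (η₁/2)`.  Hence any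
counterexample to `EquilibriumAprioriBounds` refutes the crux, and any proof of the crux proves it. -/
theorem equilibriumAprioriBounds_of_aprioriBounds (h : AprioriBounds) : EquilibriumAprioriBounds := by
  intro θ₀ hθ₀
  obtain ⟨σc, hσc, η₁, hη₁, H⟩ := h (fun _ => 1) (fun _ => θ₀) (fun _ => 0) continuous_const
    continuous_const continuous_const (fun _ => one_pos) (fun _ => hθ₀)
  obtain ⟨σ₁, hσ₁, -, hL⟩ := LocalSecondLawNegative.homogeneous_lln_identified hθ₀
  refine ⟨min σc (min σ₁ (min 1 (η₁ / 2))),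
    lt_min hσc (lt_min hσ₁ (lt_min one_pos (half_pos hη₁))), fun σ hσ hσlt Φ t ht => ?_⟩
  have hσc' : σ < σc := hσlt.trans_le (min_le_left _ _)
  have hσ₁' : σ < σ₁ := hσlt.trans_le ((min_le_right _ _).trans (min_le_left _ _))
  have hσ1 : σ < 1 := hσlt.trans_le ((min_le_right _ _).trans ((min_le_right _ _).trans (min_le_left _ _)))
  have hση : σ < η₁ / 2 :=
    hσlt.trans_le ((min_le_right _ _).trans ((min_le_right _ _).trans (min_le_right _ _)))
  have hσ3 : σ ^ 3 ≤ σ := pow_le_of_le_one hσ.le hσ1.le three_ne_zero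
  have hdil : ∀ s ∈ Icc 0 t, ∀ _x : T3, 2 * (fun (_ : ℝ) (_ : T3) => (1 : ℝ)) s _x * σ ^ 3 < η₁ := by
    intro s _ x
    show 2 * 1 * σ ^ 3 < η₁
    linarith
  exact H σ hσ hσc' (t + 1) (fun _ _ => 1) (fun _ _ => θ₀) (fun _ _ => 0)
    (DenseExcursionUntied.isHardSphereEulerSolution_const σ (t + 1) 0 one_pos hθ₀) Φ (hL σ hσ hσ₁' Φ) t ht (by linarith) hdil

/-- On the rung every floor constant is at most `1`: some block always has density `≤ ∫φ_N = 1`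
(`badEventII_eq_univ_of_one_lt_c1`), the laws are probability measures for `σ ≤ 1/2`, and a sequence
that is `1` infinitely often does not tend to `0`.  With `equilibriumAprioriBounds_of_aprioriBounds` this is
an unconditional constraint on the witnesses `c₁` of the live crux. -/
theorem equilibrium_floor_le_one {σ θ₀ t c₁ : ℝ} (hθ₀ : 0 < θ₀) (hσ2 : σ ≤ 1 / 2)
    {Φ : (N : ℕ) → HardSphereFlow (Torus.geometry (Fin 3)) (hsDiameter σ N) (N + 1)} (ht : 0 ≤ t)
    {γ C : ℝ} {φ : ℕ → T3 → ℝ} (hint : ∀ N, Integrable (φ N)) (hone : ∀ N, ∫ y, φ N y = 1)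
    (hlim : Tendsto (fun N : ℕ => localGibbsLaw σ (fun _ => 1) (fun _ => 0) (fun _ => θ₀) N (Φ N)
      {z | ∃ s ∈ Icc 0 t, ∃ x : T3,
        empiricalDensityField ((Φ N).flow s z) (fun y => φ N (y - x)) < c₁ ∨
          1 < empiricalDensityField ((Φ N).flow s z) (fun y => φ N (y - x)) * σ ^ 3}) atTop (𝓝 0))
    (_hγ : 0 < γ) (_hC : 0 ≤ C) : c₁ ≤ 1 := by
  by_contra hc
  push Not at hc
  have hprob : ∀ N, IsProbabilityMeasure
      (localGibbsLaw σ (fun _ => (1 : ℝ)) (fun _ => (0 : V3)) (fun _ => θ₀) N (Φ N)) := fun N =>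
    isProbabilityMeasure_localGibbsLaw continuous_const continuous_const continuous_const
      (fun _ => one_pos) (fun _ => hθ₀) hσ2 N (Φ N)
  have huniv : ∀ N, {z : Config (N + 1) (Fin 3) T3 | ∃ s ∈ Icc 0 t, ∃ x : T3,
      empiricalDensityField ((Φ N).flow s z) (fun y => φ N (y - x)) < c₁ ∨
        1 < empiricalDensityField ((Φ N).flow s z) (fun y => φ N (y - x)) * σ ^ 3} = univ := fun N =>
    badEventII_eq_univ_of_one_lt_c1 (Φ N) (hint N) (hone N) ht hc
  have hone' : ∀ N, (1 : ℝ≥0∞) ≤ localGibbsLaw σ (fun _ => (1 : ℝ)) (fun _ => (0 : V3)) (fun _ => θ₀) N (Φ N)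
      {z | ∃ s ∈ Icc 0 t, ∃ x : T3,
        empiricalDensityField ((Φ N).flow s z) (fun y => φ N (y - x)) < c₁ ∨
          1 < empiricalDensityField ((Φ N).flow s z) (fun y => φ N (y - x)) * σ ^ 3} := by
    intro N
    haveI := hprob N
    rw [huniv N, measure_univ]
  have h10 : (1 : ℝ≥0∞) ≤ 0 := ge_of_tendsto' hlim hone'
  exact absurd h10 (by simp)

/-! ## §3 The `∀ λ` strengthening of the live crux is false (unconditional) -/

/-- The natural strengthening of the crux in which the exponential parameter of (i) is UNIVERSAL
(`∀ λ > 0 ∃ C`) instead of existential; everything else — prefix, horizon, chamber clause — verbatim, and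
component (ii) dropped (which only weakens the statement refuted below). -/
def AprioriBoundsAllLambda : Prop :=
  ∀ (a₀ θ₀ : T3 → ℝ) (u₀ : T3 → V3), Continuous a₀ → Continuous θ₀ → Continuous u₀ →
    (∀ x, 0 < a₀ x) → (∀ x, 0 < θ₀ x) →
    ∃ σ₀ : ℝ, 0 < σ₀ ∧ ∃ η₁ : ℝ, 0 < η₁ ∧ ∀ σ : ℝ, 0 < σ → σ < σ₀ →
      ∀ (T : ℝ) (ρ θ : ℝ → T3 → ℝ) (u : ℝ → T3 → V3), IsHardSphereEulerSolution σ T ρ u θ →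
      ∀ Φ : (N : ℕ) → HardSphereFlow (Torus.geometry (Fin 3)) (hsDiameter σ N) (N + 1),
        TendstoHydroFieldsAt (fun N => localGibbsLaw σ a₀ u₀ θ₀ N (Φ N)) Φ ρ u θ 0 →
        ∀ t : ℝ, 0 < t → t < T → (∀ s ∈ Icc 0 t, ∀ x, 2 * ρ s x * σ ^ 3 < η₁) →
          ∀ lam : ℝ, 0 < lam → ∃ Cexp : ℝ,
            Tendsto (fun N : ℕ => localGibbsLaw σ a₀ u₀ θ₀ N (Φ N)
              {z | Cexp < ∫ s in Icc 0 t, ∫ y, Real.exp (lam * ‖y.2‖ ^ 2)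
                ∂(empiricalMeasure ((Φ N).flow s z))}) atTop (𝓝 0)

/-- **The `∀ λ` strengthening is false.**  At the homogeneous profiles `(1, θ₀, 0)` (any `θ₀ > 0`) the
prefix is discharged for every `0 < σ < min σ₀ σ₁ 1 (η₁/2)` exactly as in
`equilibriumAprioriBounds_of_aprioriBounds`, which yields the all-`λ` bound of
`AprioriBoundsIAllLambdaAt σ (1, θ₀, 0)` for every flow family and every `t > 0`; that is refuted by
`aprioriBoundsI_allLambda_false_at_equilibrium` (critical moment `λ = 1/(2θ₀)`, Alexander's regularised flow,
flow-invariance of the homogeneous Gibbs law, Markov–Tonelli).  MESSAGE: `λ` must be allowed to depend on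
the data — any `λ ≥ 1/(2 sup θ)` fails already at equilibrium. -/
theorem aprioriBoundsAllLambda_false : ¬ AprioriBoundsAllLambda := by
  intro h
  obtain ⟨σc, hσc, η₁, hη₁, H⟩ := h (fun _ => 1) (fun _ => 1) (fun _ => 0) continuous_const
    continuous_const continuous_const (fun _ => one_pos) (fun _ => one_pos)
  obtain ⟨σ₁, hσ₁, hσ₁2, hL⟩ := LocalSecondLawNegative.homogeneous_lln_identified one_pos
  set σ : ℝ := min σc (min σ₁ (min 1 (η₁ / 2))) / 2 with hσdef
  have hm : 0 < min σc (min σ₁ (min 1 (η₁ / 2))) :=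
    lt_min hσc (lt_min hσ₁ (lt_min one_pos (half_pos hη₁)))
  have hσ : 0 < σ := by positivity
  have hσlt : σ < min σc (min σ₁ (min 1 (η₁ / 2))) := by rw [hσdef]; linarith
  have hσc' : σ < σc := hσlt.trans_le (min_le_left _ _)
  have hσ₁' : σ < σ₁ := hσlt.trans_le ((min_le_right _ _).trans (min_le_left _ _))
  have hσ1 : σ < 1 := hσlt.trans_le ((min_le_right _ _).trans ((min_le_right _ _).trans (min_le_left _ _)))
  have hση : σ < η₁ / 2 :=
    hσlt.trans_le ((min_le_right _ _).trans ((min_le_right _ _).trans (min_le_right _ _)))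
  have hσhalf : σ < 1 / 2 := lt_of_lt_of_le hσ₁' hσ₁2
  have hσ3 : σ ^ 3 ≤ σ := pow_le_of_le_one hσ.le hσ1.le three_ne_zero
  have hall : AprioriBoundsIAllLambdaAt σ (fun _ => 1) (fun _ => 1) (fun _ => 0) := by
    intro Φ t ht lam hlam
    have hdil : ∀ s ∈ Icc 0 t, ∀ _x : T3, 2 * (fun (_ : ℝ) (_ : T3) => (1 : ℝ)) s _x * σ ^ 3 < η₁ := by
      intro s _ x
      show 2 * 1 * σ ^ 3 < η₁
      linarith
    exact H σ hσ hσc' (t + 1) (fun _ _ => 1) (fun _ _ => 1) (fun _ _ => 0)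
      (DenseExcursionUntied.isHardSphereEulerSolution_const σ (t + 1) 0 one_pos one_pos) Φ (hL σ hσ hσ₁' Φ) t ht
      (by linarith) hdil lam hlam
  exact aprioriBoundsI_allLambda_false_at_equilibrium hσ hσhalf one_pos hall

/-- The crux itself is NOT touched by §3: it asks for SOME `λ > 0`, and the rung's (i) holds at
equilibrium for every `λ < 1/(2θ₀)` (finite Maxwellian moment, stationarity).  Recorded as the trivial
implication "crux ⇒ its (i) at equilibrium for some `λ`", the `∃ λ` shadow of `AprioriBoundsAllLambda`. -/
theorem equilibrium_partOne_of_aprioriBounds (h : AprioriBounds) {θ₀ : ℝ} (hθ₀ : 0 < θ₀) :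
    ∃ σ₀ : ℝ, 0 < σ₀ ∧ ∀ σ : ℝ, 0 < σ → σ < σ₀ →
      ∀ Φ : (N : ℕ) → HardSphereFlow (Torus.geometry (Fin 3)) (hsDiameter σ N) (N + 1),
        ∀ t : ℝ, 0 < t → PartOneAt σ (fun _ => 1) (fun _ => θ₀) (fun _ => 0) Φ t := by
  obtain ⟨σ₀, hσ₀, H⟩ := equilibriumAprioriBounds_of_aprioriBounds h θ₀ hθ₀
  exact ⟨σ₀, hσ₀, fun σ hσ hσlt Φ t ht => (H σ hσ hσlt Φ t ht).1⟩

end Summit.AtomisticToContinuum.HydrodynamicLimit.Theorems.AprioriBoundsNegative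

end
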